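import Literature.AlgebraicGeometry.Limits.FiniteLocallyFreeDescent
import Literature.AlgebraicGeometry.Limits.SubalgebraDiagram
import HarnessLib

/-!
# Vector bundles on `P ×_K Spec B` come from `P ×_K Spec K[t]` for a finitely generated
# subalgebra `K[t] ⊆ B` (EGA IV₃ 8.5.2 (ii), 8.5.5; The Stacks Project, Lemma 32.10.3 (1))

Topic: `Literature/AlgebraicGeometry/Limits`. Let `K` be a commutative ring, `B` a commutative
`K`-algebra and `P` a quasi-compact quasi-separated `K`-scheme. `Limits/SubalgebraDiagram`
presents `P ×_K Spec B = (P ⊗ Spec B).left` as the cofiltered limit of the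
`P ×_K Spec K[t] = (P ⊗ Spec K[t]).left`, `t ⊇ s₁` finite subsets of `B`
(`SubalgApprox.isLimitProdCone`; affine transition maps, quasi-compact quasi-separated stages).
Applying `Limits/FiniteLocallyFreeDescent` (Stacks 0B8W (1)):

* `exists_isFiniteLocallyFree_pullback_iso_subalgebra` — **every finite locally free module on
  `P ×_K Spec B` is the pull-back of a finite locally free module on `P ×_K Spec K[t]` for some
  finite `t ⊆ B` containing `s₁`.**

Typical use (`K = R` a finitely generated `ℤ`-algebra, `B = ℂ` an `R`-algebra through a complex
point, `P = Y` a projective `R`-scheme): a vector bundle on the complex fibre `Y ⊗_R ℂ` has a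
model over `Y ⊗_R R[t]`, `R[t] ⊆ ℂ` finitely generated — the first step in reducing a class of
`K₀(Y_ℂ)` modulo `p`. Everything is proved; no named facts.

## References

* The Stacks Project, Lemma 32.10.3 (1) (Tag 0B8W). [StacksProject]
* A. Grothendieck, J. Dieudonné, EGA IV₃ (1966), Thm. 8.5.2 (ii), Cor. 8.5.5. [EGAIV3]
* U. Görtz, T. Wedhorn, *Algebraic Geometry I*, 2nd ed. (2020), (10.13), Thm. 10.60.
  [GortzWedhorn2020]
-/

universe u

open CategoryTheory CategoryTheory.Limits AlgebraicGeometry MonoidalCategory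
open Literature.AlgebraicGeometry.Motives

namespace Literature.AlgebraicGeometry.Limits

set_option backward.isDefEq.respectTransparency false

/-- **Finite locally free modules on `P ×_K Spec B` come from a finitely generated subalgebra**:
for `P` a quasi-compact quasi-separated `K`-scheme, `B` a `K`-algebra, `s₁ ⊆ B` finite and `E` a
finite locally free module on `(P ⊗ Spec B).left`, there are a finite `t ⊇ s₁` and a finite
locally free module `ℰ` on `(P ⊗ Spec K[t]).left` whose pull-back along
`(P ⊗ Spec B).left ⟶ (P ⊗ Spec K[t]).left` is isomorphic to `E` (Stacks 0B8W (1) for the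
system `SubalgApprox.prodCone`; EGA IV₃ 8.5.2 (ii) with 8.5.5).
[cite: StacksProject, Tag 0B8W (Lemma 32.10.3 (1))] [cite: EGAIV3, Thm. 8.5.2 (ii), Cor. 8.5.5] -/
theorem exists_isFiniteLocallyFree_pullback_iso_subalgebra (K B : Type u) [CommRing K]
    [CommRing B] [Algebra K B] (s₁ : Finset B) (P : SchemeOver K) [QuasiCompact P.hom]
    [QuasiSeparated P.hom] {E : (SubalgApprox.prodCone K B s₁ P).pt.Modules}
    (hE : IsFiniteLocallyFree E) :
    ∃ (t : (SubalgApprox.Idx B s₁)ᵒᵖ) (ℰ : ((SubalgApprox.prodDiagram K B s₁ P).obj t).Modules),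
      IsFiniteLocallyFree ℰ ∧
      Nonempty ((Scheme.Modules.pullback ((SubalgApprox.prodCone K B s₁ P).π.app t)).obj ℰ ≅ E) :=
  exists_isFiniteLocallyFree_pullback_iso (SubalgApprox.prodDiagram K B s₁ P)
    (SubalgApprox.prodCone K B s₁ P) (SubalgApprox.isLimitProdCone K B s₁ P) hE

end Literature.AlgebraicGeometry.Limits
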